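import Summits.NavierStokesRegularity.NavierStokesRegularity.Theorems.SoloSalvageWu2026ConstructCompactTools
import Summits.NavierStokesRegularity.NavierStokesRegularity.Theorems.SoloSalvageWu2026ConstructProfile
import Literature.Analysis.FunctionSpaces.SobolevTraceRellichProofs
import Literature.Analysis.FunctionSpaces.BallLipschitzDomain
import Mathlib.MeasureTheory.Function.LpSpace.Complete
import HarnessLib

/-!
# C177 `Wu2026` — sub-binder (A) of `Step_construct` (velocity compactness (3.26)–(3.28)) REDUCED to
# a uniform local gradient bound, by the tree's Rellich–Kondrachov theorem (cell `pub/ns-inputs`,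
# seat `ns-in-wu-con`; route business of `GaldiLiouvilleGate`, item stmt-NavierStokesRegularity-0897)

Piece (A) of `step_construct_of_pieces` (`SoloSalvageWu2026Construct.lean`) asks for a subsequence of
ANY scales `R_j = 2^{n_j}` along which the blow-downs `V_j = R_j^{2/3}v(R_j·)` converge in
`L⁴_loc(ℝ³ ∖ {0})`. Printed route (p.11 l.13–50): uniform local `W^{1,s}` bounds, Rellich on bounded
pieces, «a nested exhaustion by bounded Lipschitz domains and … a diagonal subsequence» (3.28). This
file PROVES (A) from the single analytic input that is not yet a tree theorem, typed as the
hypothesis `hG1`: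

  (G1) for every admissible ball `B(c, |c|/3)`, `c ≠ 0`, the gradients are bounded in `L¹`:
       `sup_j ∫_{B(c,|c|/3)} |∇V_j| < ∞`

(in print: from `curl V_j ∈ L^{9/5,∞}` uniformly, `div V_j = 0` and the local div–curl /
Calderón–Zygmund estimate, (3.21)–(3.25) p.10–11). Given (G1): the annular bound (3.18) is scale
invariant (`integral_annulus_blowDown_rpow_le`), so `V_j` is bounded in `L^{17/4}` and `L¹` on every
admissible ball; the tree's Rellich–Kondrachov theorem on the bounded Lipschitz domain `B(c,|c|/3)`
(`Literature.Analysis.FunctionSpaces.RellichDomain.exists_finset_eLpNorm_sub_lt_of_isLipschitzDomain`,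
`isLipschitzDomain_ball`, weak derivatives of `C¹` fields `HasWeakFDerivOn.of_contDiff_holds`) makes
each sequence `(V_j|_{B_k})_j` totally bounded in `L¹(B_k)` for a countable cover `(B_k)` of
`ℝ³ ∖ {0}` (`exists_centres_cover_punctured`); ONE subsequence converging in every `L¹(B_k)` is
extracted by compactness of the product `Π_k closure{V_j|_{B_k}}` (Tychonoff + first countability —
the diagonal argument), the limits are glued a.e.-consistently into `V`, and `L¹(B_k) → L⁴(B_k)` by
interpolation against the uniform `L^{17/4}` bound (`tendsto_lintegral_rpow_four_of_one`); compact
`K ⊆ ℝ³ ∖ {0}` are covered by finitely many `B_k`.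

Theorems only, standard axioms, no `sorry`.

WHAT THIS IS NOT: not a proof of `Step_construct` (the gradient bound (G1), piece (B) and piece (E)
remain); not a claim about NS regularity or blow-up; not a claim about any author beyond the typed
locator.
-/

set_option linter.dupNamespace false

noncomputable section

open MeasureTheory Set Filter Topology Module Metric TopologicalSpace
open scoped ENNReal NNReal Topology RealInnerProductSpace Pointwise

namespace Summit.NavierStokesRegularity.NavierStokesRegularity.Theorems.Wu2026Salvage

open Literature.Analysis.FluidPDE Literature.Analysis.FunctionSpaces Literature.Claims.NS.Wu2026
open Literature.Analysis.FunctionSpaces.RellichDomain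

/-- A continuous function is integrable on a ball. [folklore] -/
theorem integrableOn_ball_of_continuous {F : Type*} [NormedAddCommGroup F] {f : E3 → F}
    (hf : Continuous f) (c : E3) (r : ℝ) : IntegrableOn f (ball c r) volume :=
  (hf.continuousOn.integrableOn_compact (isCompact_closedBall c r)).mono_set ball_subset_closedBall

/-- A continuous function is integrable on an annulus. [folklore] -/
theorem integrableOn_annulus_of_continuous {F : Type*} [NormedAddCommGroup F] {f : E3 → F}
    (hf : Continuous f) (R : ℝ) : IntegrableOn f (annulus R) volume := by
  refine (hf.continuousOn.integrableOn_compact (isCompact_closedBall (0 : E3) (2 * R))).mono_set ?_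
  intro y hy
  rw [mem_closedBall, dist_zero_right]
  exact hy.2.le

/-- **Sub-binder (A) of `Step_construct` from the uniform local gradient bound (G1)** (p.11
l.13–50: Rellich on bounded pieces, nested exhaustion, diagonal subsequence — (3.26)–(3.28)).
The conclusion is hypothesis `hA` of `step_construct_of_pieces` verbatim. [cite: Wu2026, (3.26)–(3.28) p.11] -/
theorem step_construct_pieceA_of_localGradBound
    (hG1 : ∀ ν : ℝ, 0 < ν → ∀ (v : E3 → E3) (p : E3 → ℝ), IsWuFlow ν v p →
      MemWeakLp v ((9 : ℝ≥0∞) / 2) volume →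
      (∀ q : ℝ, 1 < q → q < 9 / 2 → ∃ C : ℝ, ∀ R : ℝ, 0 < R →
        IntegrableOn (fun x => ‖v x‖ ^ q) (annulus R) ∧
        (∫ x in annulus R, ‖v x‖ ^ q) ^ (1 / q) ≤ C * R ^ (-(2 : ℝ) / 3 + 3 / q)) →
      ∀ n : ℕ → ℕ, ∀ c : E3, c ≠ 0 → ∃ C : ℝ, ∀ j : ℕ,
        ∫ y in ball c (‖c‖ / 3), ‖fderiv ℝ (blowDown ((2 : ℝ) ^ n j) v) y‖ ≤ C) :
    ∀ ν : ℝ, 0 < ν → ∀ (v : E3 → E3) (p : E3 → ℝ), IsWuFlow ν v p →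
      MemWeakLp v ((9 : ℝ≥0∞) / 2) volume →
      (∀ q : ℝ, 1 < q → q < 9 / 2 → ∃ C : ℝ, ∀ R : ℝ, 0 < R →
        IntegrableOn (fun x => ‖v x‖ ^ q) (annulus R) ∧
        (∫ x in annulus R, ‖v x‖ ^ q) ^ (1 / q) ≤ C * R ^ (-(2 : ℝ) / 3 + 3 / q)) →
      ∀ n : ℕ → ℕ, Tendsto n atTop atTop →
      ∃ σ : ℕ → ℕ, StrictMono σ ∧ ∃ V : E3 → E3, AEStronglyMeasurable V volume ∧
        (∀ K : Set E3, IsCompact K → K ⊆ punctured →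
          IntegrableOn (fun y => ‖V y‖ ^ (4 : ℝ)) K) ∧
        (∀ K : Set E3, IsCompact K → K ⊆ punctured →
          Tendsto (fun j => ∫ y in K, ‖blowDown ((2 : ℝ) ^ n (σ j)) v y - V y‖ ^ (4 : ℝ))
            atTop (𝓝 0)) := by
  classical
  intro ν hν v p hflow hweak h318 n _hn
  -- the rescaled fields
  set Vj : ℕ → E3 → E3 := fun j => blowDown ((2 : ℝ) ^ n j) v with hVj_def
  have hRpos : ∀ j, (0 : ℝ) < (2 : ℝ) ^ n j := fun j => pow_pos two_pos _
  have hVs : ∀ j, ContDiff ℝ (⊤ : ℕ∞) (Vj j) := fun j => contDiff_blowDown hflow.smooth_v _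
  have hV1 : ∀ j, ContDiff ℝ 1 (Vj j) := fun j => (hVs j).of_le (by norm_cast)
  have hVc : ∀ j, Continuous (Vj j) := fun j => (hVs j).continuous
  have hDVc : ∀ j, Continuous (fderiv ℝ (Vj j)) := fun j => (hV1 j).continuous_fderiv one_ne_zero
  have hVm : ∀ j, AEStronglyMeasurable (Vj j) volume := fun j => (hVc j).aestronglyMeasurable
  -- the countable cover by admissible balls
  obtain ⟨c, hc0, hcover⟩ := exists_centres_cover_punctured
  set B : ℕ → Set E3 := fun k => ball (c k) (‖c k‖ / 3) with hB_def
  have hBmeas : ∀ k, MeasurableSet (B k) := fun k => measurableSet_ball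
  have hBfin : ∀ k, volume (B k) ≠ ∞ := fun k => measure_ball_lt_top.ne
  have hBann : ∀ k, B k ⊆ annulus (2 * ‖c k‖ / 3) := fun k => ball_subset_annulus (hc0 k)
  let Ω : ℕ → Opens E3 := fun k => ⟨B k, isOpen_ball⟩
  -- uniform `L^q` bound on each ball, `q = 17/4`, from (3.18)
  set q : ℝ := 17 / 4 with hq_def
  have hq4 : (4 : ℝ) < q := by norm_num
  obtain ⟨Cq, hCq⟩ := h318 q (by norm_num) (by norm_num)
  set Mq : ℕ → ℝ≥0∞ := fun k =>
    ENNReal.ofReal ((Cq * (2 * ‖c k‖ / 3) ^ (-(2 : ℝ) / 3 + 3 / q)) ^ q) with hMq_def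
  have hMq : ∀ k j, ∫⁻ y in B k, ‖Vj j y‖ₑ ^ q ≤ Mq k := by
    intro k j
    have hRk : 0 < 2 * ‖c k‖ / 3 := by have := norm_pos_iff.2 (hc0 k); positivity
    have hcont : Continuous fun y => ‖Vj j y‖ ^ q :=
      (hVc j).norm.rpow_const fun _ => Or.inr (by norm_num)
    have hint : IntegrableOn (fun y => ‖Vj j y‖ ^ q) (annulus (2 * ‖c k‖ / 3)) volume :=
      integrableOn_annulus_of_continuous hcont _
    calc ∫⁻ y in B k, ‖Vj j y‖ₑ ^ q ≤ ∫⁻ y in annulus (2 * ‖c k‖ / 3), ‖Vj j y‖ₑ ^ q :=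
          lintegral_mono_set (hBann k)
      _ = ∫⁻ y in annulus (2 * ‖c k‖ / 3), ENNReal.ofReal (‖Vj j y‖ ^ q) :=
          lintegral_congr fun y => (ofReal_norm_rpow _ (by norm_num)).symm
      _ = ENNReal.ofReal (∫ y in annulus (2 * ‖c k‖ / 3), ‖Vj j y‖ ^ q) :=
          (ofReal_integral_eq_lintegral_ofReal hint
            (Eventually.of_forall fun y => Real.rpow_nonneg (norm_nonneg _) _)).symm
      _ ≤ Mq k := ENNReal.ofReal_le_ofReal
          (integral_annulus_blowDown_rpow_le (by norm_num) hCq (hRpos j) hRk)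
  -- uniform `L¹` bounds on each ball: `V_j` by Hölder, `∇V_j` by (G1)
  set A : ℕ → ℝ≥0∞ := fun k => Mq k ^ (1 / q) * volume (B k) ^ (1 - 1 / q) with hA_def
  have hAfin : ∀ k, A k ≠ ∞ := fun k => ENNReal.mul_ne_top
    (ENNReal.rpow_ne_top_of_nonneg (by norm_num) ENNReal.ofReal_ne_top)
    (ENNReal.rpow_ne_top_of_nonneg (by norm_num) (hBfin k))
  have hmem1 : ∀ k j, MemLp (Vj j) 1 (volume.restrict (B k)) := fun k j =>
    memLp_one_iff_integrable.2 (integrableOn_ball_of_continuous (hVc j) _ _)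
  have hmemg : ∀ k j, MemLp (fderiv ℝ (Vj j)) 1 (volume.restrict (B k)) := fun k j =>
    memLp_one_iff_integrable.2 (integrableOn_ball_of_continuous (hDVc j) _ _)
  have huA : ∀ k j, eLpNorm (Vj j) 1 (volume.restrict (B k)) ≤ A k := by
    intro k j
    rw [eLpNorm_one_eq_lintegral_enorm]
    have h := setLIntegral_rpow_le_of_lt (K := B k) ((hVm j).enorm.restrict) (s := 1) (r := q)
      one_pos (by norm_num)
    simp only [ENNReal.rpow_one] at h
    refine h.trans ?_
    simp only [hA_def]
    gcongr
    exact hMq k j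
  have hgrad : ∀ k, ∃ C : ℝ, ∀ j, ∫ y in B k, ‖fderiv ℝ (Vj j) y‖ ≤ C := fun k =>
    hG1 ν hν v p hflow hweak h318 n (c k) (hc0 k)
  choose Cg hCg using hgrad
  have hgB : ∀ k j, eLpNorm (fderiv ℝ (Vj j)) 1 (volume.restrict (B k)) ≤ ENNReal.ofReal (Cg k) := by
    intro k j
    rw [eLpNorm_one_eq_lintegral_enorm, ← ofReal_integral_norm_eq_lintegral_enorm
      (integrableOn_ball_of_continuous (hDVc j) _ _)]
    exact ENNReal.ofReal_le_ofReal (hCg k j)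
  have hw : ∀ k j, HasWeakFDerivOn (Ω k) volume (Vj j) (fderiv ℝ (Vj j)) := fun k j =>
    HasWeakFDerivOn.of_contDiff_holds (Ω k) volume (hV1 j)
  -- the `L¹(B_k)` elements and total boundedness (Rellich–Kondrachov)
  haveI : Fact ((1 : ℝ≥0∞) ≤ 1) := ⟨le_rfl⟩
  let Φ : (k : ℕ) → ℕ → Lp E3 1 (volume.restrict (B k)) := fun k j => (hmem1 k j).toLp (Vj j)
  have htb : ∀ k, TotallyBounded (range (Φ k)) := by
    intro k
    refine EMetric.totallyBounded_iff.2 fun ε hε => ?_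
    obtain ⟨s, hs⟩ := exists_finset_eLpNorm_sub_lt_of_isLipschitzDomain (F := E3)
      (isLipschitzDomain_ball (c k) (‖c k‖ / 3)) isBounded_ball le_rfl volume (fun j => Vj j)
      (fun j => fderiv ℝ (Vj j)) (hw k) (hmem1 k) (hmemg k) (hAfin k) ENNReal.ofReal_ne_top
      (huA k) (hgB k) hε
    refine ⟨Φ k '' s, s.finite_toSet.image _, ?_⟩
    rintro _ ⟨j, rfl⟩
    obtain ⟨m, hm, hjm⟩ := hs j
    refine mem_iUnion₂.2 ⟨Φ k m, mem_image_of_mem _ hm, ?_⟩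
    rw [Metric.mem_eball, Lp.edist_toLp_toLp]
    exact hjm
  -- ONE subsequence for all balls: compactness of the product of the closures
  let X : ℕ → ((k : ℕ) → Lp E3 1 (volume.restrict (B k))) := fun j k => Φ k j
  set S : Set ((k : ℕ) → Lp E3 1 (volume.restrict (B k))) :=
    Set.pi univ (fun k => closure (range (Φ k))) with hS_def
  have hS : IsCompact S :=
    isCompact_univ_pi fun k => (htb k).closure.isCompact_of_isClosed isClosed_closure
  have hXS : ∀ j, X j ∈ S := fun j => mem_univ_pi.2 fun k => subset_closure (mem_range_self j)
  obtain ⟨a, -, σ, hσ, hlim⟩ := hS.tendsto_subseq hXS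
  have hlimk : ∀ k, Tendsto (fun j => Φ k (σ j)) atTop (𝓝 (a k)) := fun k =>
    tendsto_pi_nhds.1 hlim k
  have hL1 : ∀ k, Tendsto (fun j => ∫⁻ y in B k, ‖Vj (σ j) y - (a k : E3 → E3) y‖ₑ) atTop
      (𝓝 0) := by
    intro k
    have h := (Lp.tendsto_Lp_iff_tendsto_eLpNorm' _ _).1 (hlimk k)
    refine (tendsto_congr fun j => ?_).1 h
    rw [eLpNorm_one_eq_lintegral_enorm]
    refine lintegral_congr_ae ?_
    filter_upwards [(hmem1 k (σ j)).coeFn_toLp] with y hy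
    rw [Pi.sub_apply, hy]
  -- a.e. consistency of the limits and the glued limit `V`
  have hcons : ∀ k k', ∀ᵐ y ∂(volume.restrict (B k ∩ B k')),
      (a k : E3 → E3) y = (a k' : E3 → E3) y := by
    intro k k'
    have hak : AEStronglyMeasurable (a k : E3 → E3) (volume.restrict (B k ∩ B k')) :=
      (Lp.aestronglyMeasurable (a k)).mono_measure (Measure.restrict_mono inter_subset_left le_rfl)
    have hak' : AEStronglyMeasurable (a k' : E3 → E3) (volume.restrict (B k ∩ B k')) :=
      (Lp.aestronglyMeasurable (a k')).mono_measure (Measure.restrict_mono inter_subset_right le_rfl)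
    have hzero : ∫⁻ y in B k ∩ B k', ‖(a k : E3 → E3) y - (a k' : E3 → E3) y‖ₑ = 0 := by
      refine le_antisymm ?_ bot_le
      have hle : ∀ j, ∫⁻ y in B k ∩ B k', ‖(a k : E3 → E3) y - (a k' : E3 → E3) y‖ₑ ≤
          (∫⁻ y in B k, ‖Vj (σ j) y - (a k : E3 → E3) y‖ₑ) +
            ∫⁻ y in B k', ‖Vj (σ j) y - (a k' : E3 → E3) y‖ₑ := by
        intro j
        calc ∫⁻ y in B k ∩ B k', ‖(a k : E3 → E3) y - (a k' : E3 → E3) y‖ₑ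
            ≤ ∫⁻ y in B k ∩ B k', (‖Vj (σ j) y - (a k : E3 → E3) y‖ₑ +
                ‖Vj (σ j) y - (a k' : E3 → E3) y‖ₑ) := by
              refine lintegral_mono fun y => ?_
              calc ‖(a k : E3 → E3) y - (a k' : E3 → E3) y‖ₑ
                  = ‖(Vj (σ j) y - (a k' : E3 → E3) y) - (Vj (σ j) y - (a k : E3 → E3) y)‖ₑ := by
                    congr 1; abel
                _ ≤ ‖Vj (σ j) y - (a k' : E3 → E3) y‖ₑ + ‖Vj (σ j) y - (a k : E3 → E3) y‖ₑ :=
                    enorm_sub_le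
                _ = _ := add_comm _ _
          _ = (∫⁻ y in B k ∩ B k', ‖Vj (σ j) y - (a k : E3 → E3) y‖ₑ) +
                ∫⁻ y in B k ∩ B k', ‖Vj (σ j) y - (a k' : E3 → E3) y‖ₑ :=
              lintegral_add_left' (((hVm (σ j)).restrict.sub hak).enorm) _
          _ ≤ _ := add_le_add (lintegral_mono_set inter_subset_left)
              (lintegral_mono_set inter_subset_right)
      have hsum := (hL1 k).add (hL1 k')
      rw [add_zero] at hsum
      exact ge_of_tendsto' hsum hle
    have hae := (lintegral_eq_zero_iff' ((hak.sub hak').enorm)).1 hzero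
    filter_upwards [hae] with y hy
    simpa [sub_eq_zero] using hy
  let V : E3 → E3 := fun y => if h : ∃ k, y ∈ B k then (a (Nat.find h) : E3 → E3) y else 0
  have hVk : ∀ k, V =ᵐ[volume.restrict (B k)] (a k : E3 → E3) := by
    intro k
    have hall : ∀ᵐ y ∂(volume.restrict (B k)), ∀ k', y ∈ B k' →
        (a k' : E3 → E3) y = (a k : E3 → E3) y := by
      rw [ae_all_iff]
      intro k'
      have h := hcons k' k
      rw [ae_restrict_iff' ((hBmeas k').inter (hBmeas k))] at h
      rw [ae_restrict_iff' (hBmeas k)]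
      filter_upwards [h] with y hy hyk hyk'
      exact hy ⟨hyk', hyk⟩
    filter_upwards [ae_restrict_mem (hBmeas k), hall] with y hyk hy
    have hex : ∃ k', y ∈ B k' := ⟨k, hyk⟩
    simp only [V, dif_pos hex]
    exact hy _ (Nat.find_spec hex)
  have hVmk : ∀ k, AEStronglyMeasurable V (volume.restrict (B k)) := fun k =>
    (Lp.aestronglyMeasurable (a k)).congr (hVk k).symm
  have hVmeas : AEStronglyMeasurable V volume := by
    have h1 : AEStronglyMeasurable V (volume.restrict (⋃ k, B k)) :=
      aestronglyMeasurable_iUnion_iff.2 hVmk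
    have hU : (⋃ k, B k) = punctured := by
      apply Subset.antisymm
      · exact iUnion_subset fun k => ball_subset_punctured (hc0 k)
      · intro y hy
        exact mem_iUnion.2 (hcover y hy)
    have hae : ∀ᵐ y ∂(volume : Measure E3), y ∈ ⋃ k, B k := by
      rw [hU]
      have h0 : (volume : Measure E3) {(0 : E3)} = 0 := measure_singleton _
      have : ∀ᵐ y ∂(volume : Measure E3), y ∈ ({(0 : E3)} : Set E3)ᶜ := compl_mem_ae_iff.2 h0
      filter_upwards [this] with y hy
      exact fun h => hy (mem_singleton_iff.2 h)
    rw [Measure.restrict_eq_self_of_ae_mem hae] at h1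
    exact h1
  -- `L^q` bound of the limit and `L⁴(B_k)` convergence
  have ham : ∀ k, AEStronglyMeasurable (a k : E3 → E3) (volume.restrict (B k)) := fun k =>
    Lp.aestronglyMeasurable (a k)
  have haq : ∀ k, ∫⁻ y in B k, ‖(a k : E3 → E3) y‖ₑ ^ q ≤ Mq k := fun k =>
    lintegral_rpow_le_of_tendsto_lintegral (fun j => (hVm (σ j)).restrict) (ham k) q (hL1 k)
      (fun j => hMq k (σ j))
  have hL4 : ∀ k, Tendsto (fun j => ∫⁻ y in B k, ‖Vj (σ j) y - V y‖ₑ ^ (4 : ℝ)) atTop (𝓝 0) := by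
    intro k
    have h := tendsto_lintegral_rpow_four_of_one (fun j => (hVm (σ j)).restrict) (ham k) hq4
      (hL1 k) (ENNReal.ofReal_ne_top : Mq k ≠ ∞) (fun j => hMq k (σ j)) (haq k)
    refine (tendsto_congr fun j => lintegral_congr_ae ?_).1 h
    filter_upwards [hVk k] with y hy
    rw [hy]
  have hV4k : ∀ k, IntegrableOn (fun y => ‖V y‖ ^ (4 : ℝ)) (B k) volume := by
    intro k
    refine ⟨((hVmk k).norm.aemeasurable.pow_const _).aestronglyMeasurable, ?_⟩
    rw [hasFiniteIntegral_iff_enorm]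
    have heq : ∫⁻ y in B k, ‖‖V y‖ ^ (4 : ℝ)‖ₑ = ∫⁻ y in B k, ‖(a k : E3 → E3) y‖ₑ ^ (4 : ℝ) := by
      refine lintegral_congr_ae ?_
      filter_upwards [hVk k] with y hy
      rw [Real.enorm_eq_ofReal (Real.rpow_nonneg (norm_nonneg _) _), ofReal_norm_rpow _ (by norm_num),
        hy]
    rw [heq]
    refine lt_of_le_of_lt (setLIntegral_rpow_le_of_lt (ham k).enorm (by norm_num : (0:ℝ) < 4) hq4) ?_
    exact ENNReal.mul_lt_top
      (ENNReal.rpow_lt_top_of_nonneg (by norm_num) (ne_top_of_le_ne_top ENNReal.ofReal_ne_top (haq k)))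
      (ENNReal.rpow_lt_top_of_nonneg (by norm_num) (hBfin k))
  -- conclusion
  refine ⟨σ, hσ, V, hVmeas, fun K hK hKp => ?_, fun K hK hKp => ?_⟩
  · have hcov : K ⊆ ⋃ k, B k := fun y hy => mem_iUnion.2 (hcover y (hKp hy))
    obtain ⟨t, ht⟩ := hK.elim_finite_subcover B (fun k => isOpen_ball) hcov
    exact (integrableOn_finset_iUnion.2 fun k _ => hV4k k).mono_set ht
  · have hcov : K ⊆ ⋃ k, B k := fun y hy => mem_iUnion.2 (hcover y (hKp hy))
    obtain ⟨t, ht⟩ := hK.elim_finite_subcover B (fun k => isOpen_ball) hcov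
    -- the `ℝ≥0∞` form
    have hKlim : Tendsto (fun j => ∫⁻ y in K, ‖Vj (σ j) y - V y‖ₑ ^ (4 : ℝ)) atTop (𝓝 0) := by
      have hsum : Tendsto (fun j => ∑ k ∈ t, ∫⁻ y in B k, ‖Vj (σ j) y - V y‖ₑ ^ (4 : ℝ)) atTop
          (𝓝 0) := by
        have := tendsto_finsetSum t fun k _ => hL4 k
        simpa only [Finset.sum_const_zero] using this
      refine tendsto_zero_of_le hsum fun j => ?_
      exact (lintegral_mono_set ht).trans (lintegral_biUnion_finset_le t B _)
    -- back to the real integral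
    have hfin : ∀ j, ∫⁻ y in K, ‖Vj (σ j) y - V y‖ₑ ^ (4 : ℝ) ≠ ∞ := fun j =>
      (lintegral_enorm_sub_rpow_lt_top (hVc (σ j)) hK (by norm_num)
        ((integrableOn_finset_iUnion.2 fun k _ => hV4k k).mono_set ht)).ne
    have heq : ∀ j, ∫ y in K, ‖Vj (σ j) y - V y‖ ^ (4 : ℝ) =
        (∫⁻ y in K, ‖Vj (σ j) y - V y‖ₑ ^ (4 : ℝ)).toReal := by
      intro j
      have hmeas : AEStronglyMeasurable (fun y => ‖Vj (σ j) y - V y‖ ^ (4 : ℝ))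
          (volume.restrict K) :=
        ((((hVm (σ j)).sub hVmeas).norm.aemeasurable.pow_const _).aestronglyMeasurable).restrict
      rw [integral_eq_lintegral_of_nonneg_ae (Eventually.of_forall fun y => by positivity) hmeas]
      congr 1
      exact lintegral_congr fun y => ofReal_norm_rpow _ (by norm_num)
    show Tendsto (fun j => ∫ y in K, ‖Vj (σ j) y - V y‖ ^ (4 : ℝ)) atTop (𝓝 0)
    simp only [heq]
    have := (ENNReal.tendsto_toReal ENNReal.zero_ne_top).comp hKlim
    rw [ENNReal.toReal_zero] at this
    exact this

end Summit.NavierStokesRegularity.NavierStokesRegularity.Theorems.Wu2026Salvage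

end

-- WHAT THIS IS NOT: not a claim about NS regularity or blow-up; not a claim about any author beyond the typed locator.
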